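import Literature.Topology.FourManifolds.CappellShanesonStandardMatrix
import Literature.LinearAlgebra.Matrix.LatimerMacDuffeeIdeal
import HarnessLib

/-!
# The ideal class `[⟨Θₙ - c, d⟩]` of the standard Cappell–Shaneson matrix `X_{c,d,n}`
# (Kim–Yamada 2023, Prop. 2.14) and Gompf's conjecture from ideal-class representatives

Sibling of `CappellShanesonStandardMatrix.lean` and `CappellShanesonTraceSymmetry.lean`, serving the
named fact
`Literature.Topology.FourManifolds.kimYamada2023_nonempty_diffeomorph_sphere_four_of_trace_mem_Icc`
of `CappellShaneson.lean` (M. H. Kim, S. Yamada, *Ideal classes and Cappell–Shaneson homotopy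
4-spheres*, Kyungpook Math. J. 63 (2023) 373–411 = arXiv:1707.03860, Cor. C). The tree reduces
that fact to Gompf's three topological leaves and Theorem B for the traces `3 ≤ n ≤ 69`
(`kimYamada2023_nonempty_diffeomorph_sphere_four_of_trace_mem_Icc_of_Icc_three`). The printed proof
of Theorem B (§6.1) is a computation with the **ideal class monoids `C(ℤ[Θₙ])`**: "In Tables 2–4,
we give representatives of elements of `C(ℤ[Θₙ])` for `3 ≤ n ≤ 69`. We have to show that the
corresponding standard matrices are Gompf equivalent to `A₀`", resting on §1.1: "to confirm
Conjecture 1, it suffices to show that `Σ_{X_{c,d,n}}` is diffeomorphic to `S⁴` for finitely many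
pairs of such integers `c`, `d` for each integer `n`. (It is sufficient to check this for each
representative of `C(ℤ[Θₙ])`.)" The bridge between matrices and ideal classes is

* **Prop. 2.14** (Aitchison–Rubinstein, via Latimer–MacDuffee–Taussky): "There is a one-to-one
  correspondence between the set of similarity classes of Cappell-Shaneson matrices with trace `n`
  and `C(ℤ[Θₙ])`, which is defined by `X_{c,d,n} ↦ [⟨Θₙ - c, d⟩]`", proved in §2.3 by exhibiting
  the eigenvector `((Θₙ - n + c)(Θₙ - c), d, Θₙ - c)` of `X_{c,d,n}`, and
* **Rem. 2.21**: "`(c₀,d₀,n) ∼_S (c₁,d₁,n)` if and only if `X_{c₀,d₀,n}` and `X_{c₁,d₁,n}` are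
  similar."

This file PROVES that bridge on top of the tree's Latimer–MacDuffee–Taussky files
(`Literature/LinearAlgebra/Matrix/LatimerMacDuffee(Ideal).lean`: the `ℤ[X]/(f)`-module `ℤ³_A` of a
matrix, Taussky's Theorems 1–3) and derives the criterion by which class-group data yield
`GompfConjectureForTrace n`:

* `csIdeal c d n = ⟨Θₙ - c, d⟩ ⊆ ℤ[Θₙ] = AdjoinRoot (csPoly n)`; `⟨Θₙ - 1, 1⟩ = ℤ[Θₙ]` (Rem. 2.22);
* `nonempty_quotModule_transpose_standardCSMatrix_equiv_csIdeal` (**Prop. 2.14, §2.3**): the module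
  of `X_{c,d,n}ᵀ` — in the tree's convention `Θ` acts on columns, so the printed eigenvector of
  `X_{c,d,n}` is a `ℤ[Θₙ]`-linear map out of the module of the transpose — is isomorphic to
  `⟨Θₙ - c, d⟩`, the `ℤ`-span of the eigenvector;
* `isConj_standardCSMatrix_iff_csIdeal` (**Prop. 2.14 + Rem. 2.21**): `X_{c,d,n} ∼ X_{c',d',n}` in
  `SL(3, ℤ)` iff `(x) ⟨Θₙ - c, d⟩ = (y) ⟨Θₙ - c', d'⟩` for some non-zero `x, y` (conjugacy commutes
  with transposition, `isConj_transpose_iff`; isomorphic ideals are in the same class,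
  `exists_span_singleton_mul_eq_of_linearEquiv`, the converse of the tree's
  `linearEquivOfSpanSingletonMulEq`);
* `exists_isConj_standardCSMatrix_of_cover`, `gompfConjectureForTrace_of_cover` (**§1.1 / §6.1**):
  if every non-zero ideal of `ℤ[Θₙ]` lies in the class of some `⟨Θₙ - c, d⟩` (with a side
  condition, e.g. "`X_{c,d,n}` is Gompf equivalent to `A₀`", or the window condition of Lemma 6.1,
  `gompfConjectureForTrace_of_representatives` in `CappellShanesonTraceSymmetry.lean`), then every
  Cappell–Shaneson matrix of trace `n` is similar to such an `X_{c,d,n}`, resp. Gompf's conjecture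
  holds for trace `n`; `isConj_standardCSMatrix_one_one_of_isPrincipalIdealRing`: the
  class-number-one case (every matrix of trace `n` is similar to `X_{1,1,n} = A_{n-2}`).

So a row "`n`: `(c₁,d₁,n), …, (cₕ,dₕ,n)`" of Kim–Yamada's Tables 2–4 enters Theorem B as the
statement `∀ J ≠ 0, ∃ i, J ≈ ⟨Θₙ - cᵢ, dᵢ⟩` about the order `AdjoinRoot (csPoly n)` (the number
theory, MAGMA in the paper; for `n ≠ 27` in `[3, 69]` the order is maximal, §4.3) plus the Gompf
equivalences `X_{cᵢ,dᵢ,n} ∼ A₀` (§6.1, explicit). No named fact is introduced (D-0026). NOT here: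
any class-monoid computation; Thm. 2.6 (every Cappell–Shaneson matrix is similar to SOME standard
matrix, i.e. every class contains some `⟨Θₙ - c, d⟩`) — not needed once the representatives are
listed in this form; the injectivity of `X_{c,d,n} ↦ [⟨Θₙ - c, d⟩]` beyond Rem. 2.21.

## References

* [KimYamada2023] M. H. Kim, S. Yamada, Kyungpook Math. J. 63 (2023) 373–411 (arXiv:1707.03860):
  §1.1, §2.2 (Thm. 2.13, Latimer–MacDuffee–Taussky), §2.3 (Prop. 2.14, Rem. 2.15), §2.4
  (Rem. 2.21, Rem. 2.22), §6.1.
* [Taussky1949] O. Taussky, *On a theorem of Latimer and MacDuffee*, Canad. J. Math. 1 (1949)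
  300–302, Theorems 1–3.
* [AitchisonRubinstein1984] I. R. Aitchison, J. H. Rubinstein, Contemp. Math. 35 (1984), Appendix
  "Conjugacy in `SL(3, ℤ)`" (Theorem A3; the Theorem from Newman).
-/

noncomputable section

open Set Polynomial Ideal
open scoped MatrixGroups
open Literature.LinearAlgebra.Matrix

namespace Literature.Topology.FourManifolds

/-! ### The order `ℤ[Θₙ] = ℤ[X]/(fₙ)` -/

section Order

variable (n : ℤ)

/-- `fₙ` is monic, as an instance for the Latimer–MacDuffee–Taussky files. [folklore] -/
instance fact_monic_csPoly : Fact (csPoly n).Monic := ⟨monic_csPoly n⟩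

/-- **The root `Θₙ` of `fₙ` in `ℤ[Θₙ] = ℤ[X]/(fₙ)`** (Kim–Yamada 2023, §2.3: "Let `Θₙ` be a root of
`fₙ(x) = x³ - n x² + (n - 1) x - 1`"; the order `ℤ[Θₙ]` is rendered as `AdjoinRoot (csPoly n)`, an
integral domain by `isDomain_adjoinRoot_csPoly`). [cite: KimYamada2023, §2.3] -/
abbrev csRoot : AdjoinRoot (csPoly n) := AdjoinRoot.root (csPoly n)

/-- The cubic relation `Θₙ³ = n Θₙ² - (n - 1) Θₙ + 1` in `ℤ[Θₙ]`. [cite: KimYamada2023, §2.3] -/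
theorem csRoot_pow_three :
    csRoot n ^ 3 = (n : AdjoinRoot (csPoly n)) * csRoot n ^ 2 - ((n : AdjoinRoot (csPoly n)) - 1) *
      csRoot n + 1 := by
  have h0 : AdjoinRoot.mk (csPoly n) (X ^ 3 - C n * X ^ 2 + C (n - 1) * X - 1) = 0 :=
    AdjoinRoot.mk_self
  simp only [map_sub, map_add, map_mul, map_pow, AdjoinRoot.mk_X, map_one, eq_intCast,
    map_intCast] at h0
  linear_combination h0

/-- A non-zero integer is non-zero in `ℤ[Θₙ]`. [folklore] -/
theorem intCast_ne_zero_csRoot {d : ℤ} (hd : d ≠ 0) : (d : AdjoinRoot (csPoly n)) ≠ 0 := by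
  have h := QuotModule.algebraMap_int_ne_zero (f := csPoly n) (natDegree_csPoly n) (by norm_num) hd
  rwa [eq_intCast] at h

end Order

/-! ### Kim–Yamada's ideal `⟨Θₙ - c, d⟩` and the eigenvector of `X_{c,d,n}` (§2.3, Prop. 2.14) -/

section IdealOfStandard

variable {c d n : ℤ}

/-- **Kim–Yamada's ideal `⟨Θₙ - c, d⟩ ⊆ ℤ[Θₙ]`** attached to a triple `(c, d, n)` (Prop. 2.14: the
similarity class of `X_{c,d,n}` corresponds to the ideal class `[⟨Θₙ - c, d⟩]` of the ideal class
monoid `C(ℤ[Θₙ])`). [cite: KimYamada2023, Prop. 2.14] -/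
def csIdeal (c d n : ℤ) : Ideal (AdjoinRoot (csPoly n)) :=
  Ideal.span {csRoot n - (c : AdjoinRoot (csPoly n)), (d : AdjoinRoot (csPoly n))}

/-- `Θₙ - c ∈ ⟨Θₙ - c, d⟩`. [cite: KimYamada2023, Prop. 2.14] -/
theorem root_sub_mem_csIdeal (c d n : ℤ) :
    csRoot n - (c : AdjoinRoot (csPoly n)) ∈ csIdeal c d n :=
  Ideal.subset_span (by simp)

/-- `d ∈ ⟨Θₙ - c, d⟩`. [cite: KimYamada2023, Prop. 2.14] -/
theorem intCast_mem_csIdeal (c d n : ℤ) : (d : AdjoinRoot (csPoly n)) ∈ csIdeal c d n :=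
  Ideal.subset_span (by simp)

/-- `⟨Θₙ - c, d⟩ ≠ 0` when `d ≠ 0`. [cite: KimYamada2023, Prop. 2.14] -/
theorem csIdeal_ne_bot (c n : ℤ) (hd : d ≠ 0) : csIdeal c d n ≠ ⊥ := fun h =>
  intCast_ne_zero_csRoot n hd ((Submodule.eq_bot_iff _).mp h _ (intCast_mem_csIdeal c d n))

/-- **`⟨Θₙ - 1, 1⟩ = ℤ[Θₙ]`**: the triple `(1, 1, n)` — i.e. `X_{1,1,n} = A_{n-2}` — corresponds to
the trivial ideal class (Kim–Yamada 2023, Rem. 2.22: "`(1,1,n+2)` corresponds to the trivial element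
of the ideal class monoid `C(ℤ[Θ_{n+2}])` because `⟨Θ_{n+2} - 1, 1⟩` is principal"). [cite: KimYamada2023, Rem. 2.22] -/
theorem csIdeal_one_one (n : ℤ) : csIdeal 1 1 n = ⊤ :=
  (Ideal.eq_top_iff_one _).mpr (by simpa using intCast_mem_csIdeal 1 1 n)

/-- `fₙ(Xᵀ) = 0` for `X = X_{c,d,n}` (the transpose of a Cappell–Shaneson matrix is a
Cappell–Shaneson matrix with the same trace; Cayley–Hamilton). [cite: AitchisonRubinstein1984, Appendix, Theorem A3] -/
theorem aeval_transpose_standardCSMatrix (h : d ∣ (csPoly n).eval c) :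
    aeval ((Matrix.SpecialLinearGroup.transpose (standardCSMatrix c d n h) : SL(3, ℤ)) :
      Matrix (Fin 3) (Fin 3) ℤ) (csPoly n) = 0 := by
  have hdet : (((Matrix.SpecialLinearGroup.transpose (standardCSMatrix c d n h) : SL(3, ℤ)) :
      Matrix (Fin 3) (Fin 3) ℤ) - 1).det = 1 := by
    rw [Matrix.SpecialLinearGroup.coe_transpose, ← Matrix.transpose_one, ← Matrix.transpose_sub,
      Matrix.det_transpose]
    exact det_standardCSMatrix_sub_one h
  have htr : Matrix.trace (((Matrix.SpecialLinearGroup.transpose (standardCSMatrix c d n h) :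
      SL(3, ℤ)) : Matrix (Fin 3) (Fin 3) ℤ)) = n := by
    rw [Matrix.SpecialLinearGroup.coe_transpose, Matrix.trace_transpose, trace_standardCSMatrix]
  have key := aeval_csPoly_eq_zero _ hdet
  rwa [htr] at key

/-- **Kim–Yamada 2023, §2.3 / Prop. 2.14 (proved): the Latimer–MacDuffee–Taussky ideal of
`X_{c,d,n}` is `⟨Θₙ - c, d⟩`.** "`(x₁, x₂, x₃) = ((Θₙ - n + c)(Θₙ - c), d, Θₙ - c)` is an
eigenvector of [`X_{c,d,n}`] in `ℤ[Θₙ]³` with the eigenvalue `Θₙ`. Note that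
`⟨(Θₙ - n + c)(Θₙ - c), d, Θₙ - c⟩ = ⟨Θₙ - c, d⟩`. Hence the ideal class `[⟨Θₙ - c, d⟩]` corresponds to
the standard matrix `X_{c,d,n}`." In the tree's rendering of the correspondence
(`Literature.LinearAlgebra.Matrix.QuotModule f A`: `ℤ³` with `Θ` acting as the matrix `A` on
columns, so that an eigenvector `x` of `A`, `A x = Θ x`, gives the `ℤ[Θ]`-linear map
`v ↦ Σ vⱼ xⱼ` out of the module of `Aᵀ`), this is an isomorphism of `ℤ[Θₙ]`-modules
`ℤ³_{X_{c,d,n}ᵀ} ≅ ⟨Θₙ - c, d⟩` onto the `ℤ`-span `ℤ x₁ + ℤ x₂ + ℤ x₃` of the eigenvector. [cite: KimYamada2023, Prop. 2.14] -/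
theorem nonempty_quotModule_transpose_standardCSMatrix_equiv_csIdeal (h : d ∣ (csPoly n).eval c) :
    Nonempty (QuotModule (csPoly n)
      ((Matrix.SpecialLinearGroup.transpose (standardCSMatrix c d n h) : SL(3, ℤ)) :
        Matrix (Fin 3) (Fin 3) ℤ) (aeval_transpose_standardCSMatrix h) ≃ₗ[AdjoinRoot (csPoly n)]
        csIdeal c d n) := by
  set r := csRoot n with hr
  have rel := csRoot_pow_three n
  rw [← hr] at rel
  have hrel : (csEntryA c d n : AdjoinRoot (csPoly n)) * (d : AdjoinRoot (csPoly n)) +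
      ((c : AdjoinRoot (csPoly n)) ^ 3 - (n : AdjoinRoot (csPoly n)) * (c : AdjoinRoot (csPoly n)) ^ 2
        + ((n : AdjoinRoot (csPoly n)) - 1) * (c : AdjoinRoot (csPoly n)) - 1) = 0 := by
    have h1 : csEntryA c d n * d + (c ^ 3 - n * c ^ 2 + (n - 1) * c - 1) = 0 := by
      rw [csEntryA_mul h, eval_csPoly]; ring
    have h2 := congrArg (fun z : ℤ => (z : AdjoinRoot (csPoly n))) h1
    simpa using h2
  set hA := aeval_transpose_standardCSMatrix h
  -- the eigenvector of `X_{c,d,n}`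
  let β : Fin 3 → AdjoinRoot (csPoly n) :=
    ![(r - (n : AdjoinRoot (csPoly n)) + c) * (r - c), (d : AdjoinRoot (csPoly n)), r - c]
  have hβ : ∀ j, r * β j =
      ∑ i, ((((Matrix.SpecialLinearGroup.transpose (standardCSMatrix c d n h) : SL(3, ℤ)) :
        Matrix (Fin 3) (Fin 3) ℤ) i j : ℤ) : AdjoinRoot (csPoly n)) * β i := by
    intro j
    fin_cases j
    · simp [β, Fin.sum_univ_three, Matrix.SpecialLinearGroup.coe_transpose, coe_standardCSMatrix]
      linear_combination rel - hrel
    · simp [β, Fin.sum_univ_three, Matrix.SpecialLinearGroup.coe_transpose, coe_standardCSMatrix]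
      ring
    · simp [β, Fin.sum_univ_three, Matrix.SpecialLinearGroup.coe_transpose, coe_standardCSMatrix]
      ring
  let g := QuotModule.toRing (hA := hA) β hβ
  have hge1 : g (QuotModule.of _ _ hA (Pi.single 1 1)) = (d : AdjoinRoot (csPoly n)) := by
    change QuotModule.toRing β hβ _ = _
    rw [QuotModule.toRing_of]
    simp [β, Fin.sum_univ_three]
  have hge2 : g (QuotModule.of _ _ hA (Pi.single 2 1)) = r - c := by
    change QuotModule.toRing β hβ _ = _
    rw [QuotModule.toRing_of]
    simp [β, Fin.sum_univ_three]
  have hd0 : (d : AdjoinRoot (csPoly n)) ≠ 0 :=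
    intCast_ne_zero_csRoot n (ne_zero_of_dvd_eval_csPoly h)
  have hg0 : g ≠ 0 := by
    intro h0
    rw [h0, LinearMap.zero_apply] at hge1
    exact hd0 hge1.symm
  have hinj := QuotModule.injective_of_ne_zero (natDegree_csPoly n) (by norm_num) g hg0
  have hrange : LinearMap.range g = (csIdeal c d n : Ideal (AdjoinRoot (csPoly n))) := by
    apply le_antisymm
    · rintro _ ⟨m, rfl⟩
      obtain ⟨v, rfl⟩ := (QuotModule.of _ _ hA).surjective m
      change QuotModule.toRing β hβ _ ∈ _
      rw [QuotModule.toRing_of]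
      simp only [Fin.sum_univ_three, β, Matrix.cons_val_zero, Matrix.cons_val_one,
        Matrix.cons_val_two, Matrix.head_cons, Matrix.tail_cons]
      refine Ideal.add_mem _ (Ideal.add_mem _ ?_ ?_) ?_
      · rw [← mul_assoc]
        exact Ideal.mul_mem_left _ _ (root_sub_mem_csIdeal c d n)
      · exact Ideal.mul_mem_left _ _ (intCast_mem_csIdeal c d n)
      · exact Ideal.mul_mem_left _ _ (root_sub_mem_csIdeal c d n)
    · rw [csIdeal, Ideal.span_le]
      rintro z hz
      simp only [Set.mem_insert_iff, Set.mem_singleton_iff] at hz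
      rcases hz with rfl | rfl
      · exact ⟨QuotModule.of _ _ hA (Pi.single 2 1), hge2⟩
      · exact ⟨QuotModule.of _ _ hA (Pi.single 1 1), hge1⟩
  exact ⟨(LinearEquiv.ofInjective g hinj).trans (LinearEquiv.ofEq _ _ hrange)⟩

end IdealOfStandard

/-! ### Similarity classes of standard matrices and ideal classes (Prop. 2.14, Rem. 2.21) -/

section Classes

variable {c d c' d' n : ℤ}

/-- Conjugation commutes with transposition in `SL(3, ℤ)`: `A ∼ B ↔ Aᵀ ∼ Bᵀ`
(`P A P⁻¹ = B` gives `(Pᵀ)⁻¹ Aᵀ Pᵀ = Bᵀ`). [folklore] -/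
theorem isConj_transpose_iff (A B : SL(3, ℤ)) :
    IsConj (Matrix.SpecialLinearGroup.transpose A) (Matrix.SpecialLinearGroup.transpose B) ↔
      IsConj A B := by
  have key : ∀ A B : SL(3, ℤ), IsConj A B →
      IsConj (Matrix.SpecialLinearGroup.transpose A) (Matrix.SpecialLinearGroup.transpose B) := by
    intro A B h
    obtain ⟨P, hP⟩ := isConj_iff.mp h
    refine isConj_iff.mpr ⟨(Matrix.SpecialLinearGroup.transpose P)⁻¹, ?_⟩
    rw [← hP]
    refine Subtype.ext ?_
    simp only [Matrix.SpecialLinearGroup.coe_mul, Matrix.SpecialLinearGroup.coe_inv,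
      Matrix.SpecialLinearGroup.coe_transpose, inv_inv, Matrix.transpose_mul,
      Matrix.adjugate_transpose, Matrix.mul_assoc]
  exact ⟨fun h => key _ _ h, key A B⟩

/-- **Isomorphic non-zero ideals of a domain are in the same ideal class**: an `R`-linear
isomorphism `e : I ≅ J` with `0 ≠ j₀ ∈ I` gives `(e j₀) · I = (j₀) · J` (since
`j₀ e(j) = e(j₀ j) = j e(j₀)`), the converse of `linearEquivOfSpanSingletonMulEq`. This is the
remaining half of Taussky's Theorem 2 used by Kim–Yamada's Rem. 2.21 ("`(c₀,d₀,n) ∼_S (c₁,d₁,n)`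
if and only if `X_{c₀,d₀,n}` and `X_{c₁,d₁,n}` are similar"). [cite: Taussky1949, Theorem 2] -/
theorem exists_span_singleton_mul_eq_of_linearEquiv {R : Type*} [CommRing R] [IsDomain R]
    {I J : Ideal R} (e : I ≃ₗ[R] J) {j₀ : R} (hj₀ : j₀ ∈ I) (hj₀0 : j₀ ≠ 0) :
    ∃ x y : R, x ≠ 0 ∧ y ≠ 0 ∧ Ideal.span {x} * I = Ideal.span {y} * J := by
  refine ⟨(e ⟨j₀, hj₀⟩ : R), j₀, ?_, hj₀0, ?_⟩
  · intro h
    have : e ⟨j₀, hj₀⟩ = 0 := Subtype.ext h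
    exact hj₀0 (congrArg Subtype.val (e.injective (this.trans (map_zero e).symm)))
  · have hcomm : ∀ j : I, j₀ * (e j : R) = (j : R) * (e ⟨j₀, hj₀⟩ : R) := by
      intro j
      have h1 : e (j₀ • j) = j₀ • e j := map_smul e j₀ j
      have h2 : e ((j : R) • ⟨j₀, hj₀⟩) = (j : R) • e ⟨j₀, hj₀⟩ := map_smul e (j : R) ⟨j₀, hj₀⟩
      have h3 : j₀ • j = (j : R) • (⟨j₀, hj₀⟩ : I) := by
        apply Subtype.ext
        simp [mul_comm]
      rw [h3] at h1
      have h4 := congrArg Subtype.val (h1.symm.trans h2)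
      simpa [Submodule.coe_smul] using h4
    apply le_antisymm
    · rw [Ideal.mul_le]
      intro x hx j hj
      obtain ⟨r, rfl⟩ := Ideal.mem_span_singleton'.mp hx
      have hc := hcomm ⟨j, hj⟩
      have heq : r * (e ⟨j₀, hj₀⟩ : R) * j = (r * j₀) * (e ⟨j, hj⟩ : R) := by
        linear_combination (-r) * hc
      rw [heq]
      exact Ideal.mul_mem_mul (Ideal.mul_mem_left _ _ (Ideal.mem_span_singleton_self _))
        (e ⟨j, hj⟩).2
    · rw [Ideal.mul_le]
      intro y hy k hk
      obtain ⟨r, rfl⟩ := Ideal.mem_span_singleton'.mp hy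
      obtain ⟨j, hj⟩ := e.surjective ⟨k, hk⟩
      have hk' : k = (e j : R) := by rw [hj]
      have heq : r * j₀ * k = (r * (e ⟨j₀, hj₀⟩ : R)) * (j : R) := by
        rw [hk']
        linear_combination r * hcomm j
      rw [heq]
      exact Ideal.mul_mem_mul (Ideal.mul_mem_left _ _ (Ideal.mem_span_singleton_self _)) j.2

/-- **Kim–Yamada 2023, Prop. 2.14 with Rem. 2.21 (proved): `X_{c,d,n}` and `X_{c',d',n}` are similar
if and only if the ideals `⟨Θₙ - c, d⟩` and `⟨Θₙ - c', d'⟩` are in the same class**, i.e.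
`(x) ⟨Θₙ - c, d⟩ = (y) ⟨Θₙ - c', d'⟩` for some non-zero `x, y ∈ ℤ[Θₙ]` ("There is a one-to-one
correspondence between the set of similarity classes of Cappell–Shaneson matrices with trace `n` and
`C(ℤ[Θₙ])`, which is defined by `X_{c,d,n} ↦ [⟨Θₙ - c, d⟩]`"; Rem. 2.21: "`(c₀,d₀,n) ∼_S (c₁,d₁,n)`
if and only if `X_{c₀,d₀,n}` and `X_{c₁,d₁,n}` are similar"). Proof: Latimer–MacDuffee–Taussky
(isomorphic modules ↔ conjugate matrices, `QuotModule.linearEquivOfConj` /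
`exists_isUnit_det_of_linearEquiv`) on the transposes, and
`nonempty_quotModule_transpose_standardCSMatrix_equiv_csIdeal`. [cite: KimYamada2023, Prop. 2.14 and Rem. 2.21] -/
theorem isConj_standardCSMatrix_iff_csIdeal (h : d ∣ (csPoly n).eval c)
    (h' : d' ∣ (csPoly n).eval c') :
    IsConj (standardCSMatrix c d n h) (standardCSMatrix c' d' n h') ↔
      ∃ x y : AdjoinRoot (csPoly n), x ≠ 0 ∧ y ≠ 0 ∧
        Ideal.span {x} * csIdeal c d n = Ideal.span {y} * csIdeal c' d' n := by
  obtain ⟨e⟩ := nonempty_quotModule_transpose_standardCSMatrix_equiv_csIdeal h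
  obtain ⟨e'⟩ := nonempty_quotModule_transpose_standardCSMatrix_equiv_csIdeal h'
  constructor
  · intro hc
    obtain ⟨P, hP, hPAB⟩ := (isConj_iff_exists_isUnit_det _ _).mp ((isConj_transpose_iff _ _).mpr hc)
    let eP := QuotModule.linearEquivOfConj (f := csPoly n) (hA := aeval_transpose_standardCSMatrix h)
      (hB := aeval_transpose_standardCSMatrix h') P hP hPAB
    exact exists_span_singleton_mul_eq_of_linearEquiv (e.symm.trans (eP.trans e'))
      (intCast_mem_csIdeal c d n) (intCast_ne_zero_csRoot n (ne_zero_of_dvd_eval_csPoly h))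
  · rintro ⟨x, y, hx, hy, hxy⟩
    let eI := linearEquivOfSpanSingletonMulEq hx hy hxy
    obtain ⟨P, hP, hPAB⟩ := QuotModule.exists_isUnit_det_of_linearEquiv (e.trans (eI.trans e'.symm))
    exact (isConj_transpose_iff _ _).mp ((isConj_iff_exists_isUnit_det _ _).mpr ⟨P, hP, hPAB⟩)

/-- **Every ideal class represented by `⟨Θₙ - c, d⟩` is the class of a standard matrix**: if the
Latimer–MacDuffee–Taussky ideal `J` of (the transpose of) a Cappell–Shaneson matrix `A` of trace `n`
is in the class of `⟨Θₙ - c, d⟩`, `d ∣ fₙ(c)`, then `A` is similar to `X_{c,d,n}` (Kim–Yamada 2023,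
Prop. 2.14, the surjectivity half: "Since every matrix is similar to a standard matrix" / the
bijection with `C(ℤ[Θₙ])`). [cite: KimYamada2023, Prop. 2.14] -/
theorem isConj_standardCSMatrix_of_csIdeal {A : SL(3, ℤ)}
    (hA : aeval ((Matrix.SpecialLinearGroup.transpose A : SL(3, ℤ)) : Matrix (Fin 3) (Fin 3) ℤ)
      (csPoly n) = 0)
    {J : Ideal (AdjoinRoot (csPoly n))}
    (eJ : QuotModule (csPoly n) _ hA ≃ₗ[AdjoinRoot (csPoly n)] J)
    (h : d ∣ (csPoly n).eval c) {x y : AdjoinRoot (csPoly n)} (hx : x ≠ 0) (hy : y ≠ 0)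
    (hxy : Ideal.span {x} * J = Ideal.span {y} * csIdeal c d n) :
    IsConj A (standardCSMatrix c d n h) := by
  obtain ⟨e⟩ := nonempty_quotModule_transpose_standardCSMatrix_equiv_csIdeal h
  let eI := linearEquivOfSpanSingletonMulEq hx hy hxy
  obtain ⟨P, hP, hPAB⟩ := QuotModule.exists_isUnit_det_of_linearEquiv (eJ.trans (eI.trans e.symm))
  exact (isConj_transpose_iff _ _).mp ((isConj_iff_exists_isUnit_det _ _).mpr ⟨P, hP, hPAB⟩)

end Classes

/-! ### Gompf's conjecture for trace `n` from representatives of `C(ℤ[Θₙ])` -/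

section Criterion

variable {n : ℤ}

/-- The transpose of a Cappell–Shaneson matrix is a Cappell–Shaneson matrix. [folklore] -/
theorem det_transpose_sub_one (A : SL(3, ℤ)) :
    (((Matrix.SpecialLinearGroup.transpose A : SL(3, ℤ)) : Matrix (Fin 3) (Fin 3) ℤ) - 1).det =
      ((A : Matrix (Fin 3) (Fin 3) ℤ) - 1).det := by
  have h : ((Matrix.SpecialLinearGroup.transpose A : SL(3, ℤ)) : Matrix (Fin 3) (Fin 3) ℤ) - 1 =
      ((A : Matrix (Fin 3) (Fin 3) ℤ) - 1).transpose := by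
    rw [Matrix.transpose_sub, Matrix.transpose_one]
    rfl
  rw [h, Matrix.det_transpose]

/-- `fₙ(Aᵀ) = 0` for a Cappell–Shaneson matrix `A` of trace `n`. [cite: AitchisonRubinstein1984, Appendix, Theorem A3] -/
theorem aeval_transpose_csPoly_eq_zero (A : SL(3, ℤ)) (hdet : ((A : Matrix (Fin 3) (Fin 3) ℤ) - 1).det = 1)
    (htr : Matrix.trace (A : Matrix (Fin 3) (Fin 3) ℤ) = n) :
    aeval ((Matrix.SpecialLinearGroup.transpose A : SL(3, ℤ)) : Matrix (Fin 3) (Fin 3) ℤ)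
      (csPoly n) = 0 := by
  have key := aeval_csPoly_eq_zero (Matrix.SpecialLinearGroup.transpose A)
    (by rw [det_transpose_sub_one]; exact hdet)
  rwa [Matrix.SpecialLinearGroup.coe_transpose, Matrix.trace_transpose, htr,
    ← Matrix.SpecialLinearGroup.coe_transpose] at key

/-- **"It is sufficient to check this for each representative of `C(ℤ[Θₙ])`"** (Kim–Yamada 2023,
§1.1; the architecture of the proof of Thm. B, §6.1): if every non-zero ideal of `ℤ[Θₙ]` is in the
class of some `⟨Θₙ - c, d⟩` (`d ∣ fₙ(c)`) satisfying a property `R`, then every Cappell–Shaneson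
matrix of trace `n` is similar to a standard matrix `X_{c,d,n}` with `R c d`. (The module of `Aᵀ`
is an ideal by Taussky's Theorem 1, `QuotModule.exists_linearEquiv_ideal`; then Prop. 2.14.) [cite: KimYamada2023, §1.1 and Prop. 2.14] -/
theorem exists_isConj_standardCSMatrix_of_cover (R : ℤ → ℤ → Prop)
    (hcover : ∀ J : Ideal (AdjoinRoot (csPoly n)), J ≠ ⊥ →
      ∃ (c d : ℤ) (_ : d ∣ (csPoly n).eval c) (x y : AdjoinRoot (csPoly n)),
        x ≠ 0 ∧ y ≠ 0 ∧ Ideal.span {x} * J = Ideal.span {y} * csIdeal c d n ∧ R c d)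
    (A : SL(3, ℤ)) (hdet : ((A : Matrix (Fin 3) (Fin 3) ℤ) - 1).det = 1)
    (htr : Matrix.trace (A : Matrix (Fin 3) (Fin 3) ℤ) = n) :
    ∃ (c d : ℤ) (h : d ∣ (csPoly n).eval c), IsConj A (standardCSMatrix c d n h) ∧ R c d := by
  have hA := aeval_transpose_csPoly_eq_zero A hdet htr
  obtain ⟨J, hJ, ⟨eJ⟩⟩ := QuotModule.exists_linearEquiv_ideal (f := csPoly n)
    (A := ((Matrix.SpecialLinearGroup.transpose A : SL(3, ℤ)) : Matrix (Fin 3) (Fin 3) ℤ))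
    (hA := hA) (natDegree_csPoly n) (by norm_num)
  obtain ⟨c, d, h, x, y, hx, hy, hxy, hR⟩ := hcover J hJ
  exact ⟨c, d, h, isConj_standardCSMatrix_of_csIdeal hA eJ h hx hy hxy, hR⟩

/-- **Gompf's conjecture for trace `n` from ideal-class representatives** (Kim–Yamada 2023, §1.1:
"to confirm Conjecture 1, it suffices to show that `Σ_{X_{c,d,n}}` is diffeomorphic to `S⁴` for
finitely many pairs of such integers `c`, `d` for each integer `n`. (It is sufficient to check this
for each representative of `C(ℤ[Θₙ])`.)"; the form in which Theorem B is proved in §6.1 from the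
tables of representatives): if every non-zero ideal of `ℤ[Θₙ]` lies in the class of some
`⟨Θₙ - c, d⟩` whose standard matrix `X_{c,d,n}` is Gompf equivalent to `A₀`, then
`GompfConjectureForTrace n`. [cite: KimYamada2023, §1.1 and §6.1] -/
theorem gompfConjectureForTrace_of_cover
    (hcover : ∀ J : Ideal (AdjoinRoot (csPoly n)), J ≠ ⊥ →
      ∃ (c d : ℤ) (h : d ∣ (csPoly n).eval c) (x y : AdjoinRoot (csPoly n)),
        x ≠ 0 ∧ y ≠ 0 ∧ Ideal.span {x} * J = Ideal.span {y} * csIdeal c d n ∧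
          GompfEquiv (standardCSMatrix c d n h) akbulutKirbyMatrix) :
    GompfConjectureForTrace n := by
  intro A hdet htr
  obtain ⟨c, d, h, hconj, hG⟩ := exists_isConj_standardCSMatrix_of_cover
    (fun c d => ∃ h : d ∣ (csPoly n).eval c, GompfEquiv (standardCSMatrix c d n h) akbulutKirbyMatrix)
    (fun J hJ => by
      obtain ⟨c, d, h, x, y, hx, hy, hxy, hG⟩ := hcover J hJ
      exact ⟨c, d, h, x, y, hx, hy, hxy, h, hG⟩) A hdet htr
  obtain ⟨h₁, hG⟩ := hG
  exact (GompfEquiv.of_isConj hconj).trans hG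

/-- **The class-number-one case**: if `ℤ[Θₙ]` is a principal ideal ring then every Cappell–Shaneson
matrix of trace `n` is similar to `X_{1,1,n} = A_{n-2}` (the trivial class `⟨Θₙ - 1, 1⟩ = ℤ[Θₙ]`,
Rem. 2.22), recovering the route of `CappellShanesonClassNumbers.lean` through Prop. 2.14. [cite: KimYamada2023, Rem. 2.22 and Prop. 2.14] -/
theorem isConj_standardCSMatrix_one_one_of_isPrincipalIdealRing
    [IsPrincipalIdealRing (AdjoinRoot (csPoly n))] (A : SL(3, ℤ))
    (hdet : ((A : Matrix (Fin 3) (Fin 3) ℤ) - 1).det = 1)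
    (htr : Matrix.trace (A : Matrix (Fin 3) (Fin 3) ℤ) = n) :
    IsConj A (standardCSMatrix 1 1 n (by rw [eval_csPoly_one]; norm_num)) := by
  have hcover : ∀ J : Ideal (AdjoinRoot (csPoly n)), J ≠ ⊥ →
      ∃ (c d : ℤ) (_ : d ∣ (csPoly n).eval c) (x y : AdjoinRoot (csPoly n)),
        x ≠ 0 ∧ y ≠ 0 ∧ Ideal.span {x} * J = Ideal.span {y} * csIdeal c d n ∧ (c = 1 ∧ d = 1) := by
    intro J hJ
    obtain ⟨g, hg⟩ := (IsPrincipalIdealRing.principal J).principal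
    have hg0 : g ≠ 0 := by
      rintro rfl
      exact hJ (by rw [hg, Ideal.submodule_span_eq, Ideal.span_singleton_eq_bot])
    refine ⟨1, 1, by rw [eval_csPoly_one]; norm_num, 1, g, one_ne_zero, hg0, ?_, rfl, rfl⟩
    rw [csIdeal_one_one, Ideal.span_singleton_one, Ideal.top_mul, Ideal.mul_top, hg,
      Ideal.submodule_span_eq]
  obtain ⟨c, d, h, hconj, hc, hd⟩ := exists_isConj_standardCSMatrix_of_cover _ hcover A hdet htr
  subst hc hd
  exact hconj

end Criterion

end Literature.Topology.FourManifolds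

end
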